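import Summits.Parity.GeneralizedHardyLittlewood.Theorems.PrimeLevelFamEdgeMomentsBeyondDiagonalDiagDecorOrderRungTwoHecke
import Summits.Parity.GeneralizedHardyLittlewood.Theorems.PrimeLevelFamEdgeMomentsBeyondDiagonalDiagDecorWeightRungThree
import HarnessLib

/-!
# Route `PrimeLevelFamEdge`, crux K_A `MomentsBeyondDiagonal` (stmt-Parity-20007), line «petersson_layers» v4, stub `stub_diag`:
# **RUNG 3 of the ladder, the Hecke-summed weights EXPLICITLY: orders `(1,3)`, `(3,1)` and `(3,3)`**

By `…DiagOrderSymm.subDiag_of_selbergOrderAsymptotics_of_le` and the parity factor `1 + (−1)^{i+j}`, rung `N = 3` of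
`stub_diag` adds to rung 2 (orders `(0,2)`, `(2,2)`: `…DiagDecorOrderRungTwoHecke`) exactly the orders `(1,3)`, `(3,1)` and
`(3,3)`. Instantiating the generic identity `…DiagDecorOrderHecke.heckeSum_order_eq` with the closed forms of the central
divisor-log moments on squarefree numbers (`M₀ = τ`, `M₂ = τP₂`, `M₄ = τ(3P₂² − 2P₄)` — `…DiagDecorWeightRungTwo`,
`M₆ = τ(15P₂³ − 30P₂P₄ + 16P₆)` — `…DiagDecorWeightRungThree`; odd moments vanish), with
`L = 2(log Q − log g) − log k₁ − log k₂`, `S_m = P_m(k₁) + P_m(k₂)`, `P_m(k) = Σ_{p∣k}log^m p`, and `c_ab = c_ab(g²k₁k₂/Q²)` the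
Bose coefficients `∫_{u₁>0}log^a u₁∫_{u₂>y/u₁}B(u₁+u₂)log^b u₂` (squarefree `k₁, k₂`, `Q > 0`, `g ≥ 1`). Writing `D = δ₁ + δ₂`
for the sum of the two independent symmetric divisor-log variables (`𝔼D² = S₂`, `𝔼D⁴ = 3S₂² − 2S₄`,
`𝔼D⁶ = 15S₂³ − 30S₂S₄ + 16S₆`), the coefficient of `c_ab` in `Σ_{d,e}𝔚_{ij}` is `C(i,a)C(j,b)·2^{−(i−a)−(j−b)}·𝔼[(L+D)^{i−a}(L−D)^{j−b}]`:

* `heckeSum_orderOneThree_eq` — **`Σ_{d,e}𝔚₁₃ = ττ·{(L⁴ − 3S₂² + 2S₄)/16·c₀₀ + 3(L³ − LS₂)/8·c₀₁ + 3(L² − S₂)/4·c₀₂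
  + L/2·c₀₃ + (L³ + 3LS₂)/8·c₁₀ + 3(L² + S₂)/4·c₁₁ + 3L/2·c₁₂ + c₁₃}`** — decorations `ττ`, `τP₂·τ`, `τ·τP₂`, `τP₂·τP₂`,
  `τM₄/τ` only: every monomial of its polynomial part is covered by the LANDED engines of the order-`(2,2)` chain
  (`…DiagDecorShiftedLpow`, `…DiagDecorShiftedP2Lpow`, `…DiagDecorShiftedP2P2Lpow`, `…DiagDecorM4Family`);
* `heckeSum_orderThreeOne_eq` — the mirror image (`c_ab ↔ c_ba`, `L + D ↔ L − D`);
* `heckeSum_orderThreeThree_eq` — **order `(3,3)`**: sixteen Bose coefficients, top coefficient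
  `(L⁶ − 3L⁴S₂ + 3L²(3S₂² − 2S₄) − (15S₂³ − 30S₂S₄ + 16S₆))/64` of `c₀₀`; new decorations: the one-sided `M₆`
  (engine `…DiagDecorM6Family`, landed) and the two-sided `M₄ ⊗ P₂` (inside `S₂S₄`, `S₂³`; crude block still to be built).

Pointwise identities (the Selberg-form versions follow by `…DiagDecorWeightOneOne.selbergForm_congr_squarefree` exactly as in
`…DiagDecorOrderTwoTwoHecke.selbergOrderTwoTwo_hecke_eq`). Def-free; theorems only. Helper `--supports stmt-Parity-20007`;
closes nothing; K_A, K_B and the Parity summit are NOT proved; nothing about Landau–Siegel zeros.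

## References
* E. Kowalski, P. Michel, J. VanderKam, J. reine angew. Math. 526 (2000), (21)–(28) pp. 12–15.
  [cite: KowalskiMichelVanderKam2000, (23)–(28) — derivation (Hecke-divisor bookkeeping of the order-(i,j) diagonal weight)]
-/

noncomputable section

open scoped Real ArithmeticFunction.Moebius
open Finset ArithmeticFunction Polynomial MeasureTheory Set

namespace Summit.Parity.GeneralizedHardyLittlewood.Theorems.MomentsBeyondDiagonal.DiagKernel

open Literature.NumberTheory.LFunctions Literature.NumberTheory.LFunctions.KMV2000

/-- **Order `(1,3)`** (rung 3): `Σ_{d,e}𝔚₁₃ = τ(k₁)τ(k₂)·{(L ^ 4 - 3 * S₂ ^ 2 + 2 * S₄) / 16·c₀₀ + (3 * L ^ 3 - 3 * L * S₂) / 8·c₀₁ + (3 * L ^ 2 - 3 * S₂) / 4·c₀₂ +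
  L / 2·c₀₃ + (L ^ 3 + 3 * L * S₂) / 8·c₁₀ + (3 * L ^ 2 + 3 * S₂) / 4·c₁₁ + 3 * L / 2·c₁₂ + c₁₃}(g²k₁k₂/Q²)`
(`Q > 0`, `g ≥ 1`, squarefree `k₁, k₂`; `L = 2(log Q − log g) − log k₁ − log k₂`, `S_m = P_m(k₁) + P_m(k₂)`).
[cite: KowalskiMichelVanderKam2000, (23)–(28) — derivation] -/
theorem heckeSum_orderOneThree_eq {Q : ℝ} (hQ : 0 < Q) {g k₁ k₂ : ℕ} (hg : g ≠ 0) (hk₁ : Squarefree k₁)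
    (hk₂ : Squarefree k₂) :
    ∑ d ∈ k₁.divisors, ∑ e ∈ k₂.divisors,
        ∫ u₁ in Ioi (0 : ℝ),
          (Real.log (Q / ((k₁ / d * (g * e) : ℕ) : ℝ)) + Real.log u₁) ^ 1 *
          ∫ u₂ in Ioi ((((k₁ / d * (g * e) * (g * d * (k₂ / e)) : ℕ) : ℝ) / Q ^ 2) / u₁),
            Real.exp (-(u₁ + u₂)) / (1 - Real.exp (-(u₁ + u₂))) ^ 2 *
            (Real.log (Q / ((g * d * (k₂ / e) : ℕ) : ℝ)) + Real.log u₂) ^ 3 =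
      (k₁.divisors.card : ℝ) * (k₂.divisors.card : ℝ) *
        (((2 * (Real.log Q - Real.log g) - Real.log k₁ - Real.log k₂) ^ 4 -
            3 * ((∑ p ∈ k₁.primeFactors, Real.log p ^ 2) + ∑ p ∈ k₂.primeFactors, Real.log p ^ 2) ^ 2 +
            2 * ((∑ p ∈ k₁.primeFactors, Real.log p ^ 4) + ∑ p ∈ k₂.primeFactors, Real.log p ^ 4)) / 16 *
          (∫ u₁ in Ioi (0 : ℝ), ∫ u₂ in Ioi ((((g * g * (k₁ * k₂) : ℕ) : ℝ) / Q ^ 2) / u₁),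
              Real.exp (-(u₁ + u₂)) / (1 - Real.exp (-(u₁ + u₂))) ^ 2) +
        (3 * (2 * (Real.log Q - Real.log g) - Real.log k₁ - Real.log k₂) ^ 3 -
            3 * (2 * (Real.log Q - Real.log g) - Real.log k₁ - Real.log k₂) * ((∑ p ∈ k₁.primeFactors, Real.log p ^ 2) + ∑ p ∈ k₂.primeFactors, Real.log p ^ 2)) / 8 *
          (∫ u₁ in Ioi (0 : ℝ), ∫ u₂ in Ioi ((((g * g * (k₁ * k₂) : ℕ) : ℝ) / Q ^ 2) / u₁),
              Real.exp (-(u₁ + u₂)) / (1 - Real.exp (-(u₁ + u₂))) ^ 2 * Real.log u₂) +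
        (3 * (2 * (Real.log Q - Real.log g) - Real.log k₁ - Real.log k₂) ^ 2 -
            3 * ((∑ p ∈ k₁.primeFactors, Real.log p ^ 2) + ∑ p ∈ k₂.primeFactors, Real.log p ^ 2)) / 4 *
          (∫ u₁ in Ioi (0 : ℝ), ∫ u₂ in Ioi ((((g * g * (k₁ * k₂) : ℕ) : ℝ) / Q ^ 2) / u₁),
              Real.exp (-(u₁ + u₂)) / (1 - Real.exp (-(u₁ + u₂))) ^ 2 * Real.log u₂ ^ 2) +
        (2 * (Real.log Q - Real.log g) - Real.log k₁ - Real.log k₂) / 2 *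
          (∫ u₁ in Ioi (0 : ℝ), ∫ u₂ in Ioi ((((g * g * (k₁ * k₂) : ℕ) : ℝ) / Q ^ 2) / u₁),
              Real.exp (-(u₁ + u₂)) / (1 - Real.exp (-(u₁ + u₂))) ^ 2 * Real.log u₂ ^ 3) +
        ((2 * (Real.log Q - Real.log g) - Real.log k₁ - Real.log k₂) ^ 3 +
            3 * (2 * (Real.log Q - Real.log g) - Real.log k₁ - Real.log k₂) * ((∑ p ∈ k₁.primeFactors, Real.log p ^ 2) + ∑ p ∈ k₂.primeFactors, Real.log p ^ 2)) / 8 *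
          (∫ u₁ in Ioi (0 : ℝ), Real.log u₁ * ∫ u₂ in Ioi ((((g * g * (k₁ * k₂) : ℕ) : ℝ) / Q ^ 2) / u₁),
              Real.exp (-(u₁ + u₂)) / (1 - Real.exp (-(u₁ + u₂))) ^ 2) +
        (3 * (2 * (Real.log Q - Real.log g) - Real.log k₁ - Real.log k₂) ^ 2 +
            3 * ((∑ p ∈ k₁.primeFactors, Real.log p ^ 2) + ∑ p ∈ k₂.primeFactors, Real.log p ^ 2)) / 4 *
          (∫ u₁ in Ioi (0 : ℝ), Real.log u₁ * ∫ u₂ in Ioi ((((g * g * (k₁ * k₂) : ℕ) : ℝ) / Q ^ 2) / u₁),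
              Real.exp (-(u₁ + u₂)) / (1 - Real.exp (-(u₁ + u₂))) ^ 2 * Real.log u₂) +
        3 * (2 * (Real.log Q - Real.log g) - Real.log k₁ - Real.log k₂) / 2 *
          (∫ u₁ in Ioi (0 : ℝ), Real.log u₁ * ∫ u₂ in Ioi ((((g * g * (k₁ * k₂) : ℕ) : ℝ) / Q ^ 2) / u₁),
              Real.exp (-(u₁ + u₂)) / (1 - Real.exp (-(u₁ + u₂))) ^ 2 * Real.log u₂ ^ 2) +
        (∫ u₁ in Ioi (0 : ℝ), Real.log u₁ * ∫ u₂ in Ioi ((((g * g * (k₁ * k₂) : ℕ) : ℝ) / Q ^ 2) / u₁),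
              Real.exp (-(u₁ + u₂)) / (1 - Real.exp (-(u₁ + u₂))) ^ 2 * Real.log u₂ ^ 3)) := by
  rw [heckeSum_order_eq 1 3 hQ hg hk₁.ne_zero hk₂.ne_zero]
  simp only [Finset.sum_range_succ, Finset.sum_range_zero, zero_add, Nat.sub_self, Nat.sub_zero,
    Nat.choose_zero_right, Nat.choose_self, Nat.choose_one_right, Nat.succ_sub_succ_eq_sub,
    centralMoment_zero, centralMoment_one, centralMoment_three,
    centralMoment_two_of_squarefree hk₁, centralMoment_two_of_squarefree hk₂,
    centralMoment_four_of_squarefree hk₁, centralMoment_four_of_squarefree hk₂]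
  simp only [pow_zero, pow_one, one_mul, mul_one, Nat.choose]
  push_cast
  ring

/-- **Order `(3,1)`** (rung 3): `Σ_{d,e}𝔚₃₁ = τ(k₁)τ(k₂)·{(L ^ 4 - 3 * S₂ ^ 2 + 2 * S₄) / 16·c₀₀ + (L ^ 3 + 3 * L * S₂) / 8·c₀₁ + (3 * L ^ 3 - 3 * L * S₂) / 8·c₁₀ +
  (3 * L ^ 2 + 3 * S₂) / 4·c₁₁ + (3 * L ^ 2 - 3 * S₂) / 4·c₂₀ + 3 * L / 2·c₂₁ + L / 2·c₃₀ + c₃₁}(g²k₁k₂/Q²)`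
(`Q > 0`, `g ≥ 1`, squarefree `k₁, k₂`; `L = 2(log Q − log g) − log k₁ − log k₂`, `S_m = P_m(k₁) + P_m(k₂)`).
[cite: KowalskiMichelVanderKam2000, (23)–(28) — derivation] -/
theorem heckeSum_orderThreeOne_eq {Q : ℝ} (hQ : 0 < Q) {g k₁ k₂ : ℕ} (hg : g ≠ 0) (hk₁ : Squarefree k₁)
    (hk₂ : Squarefree k₂) :
    ∑ d ∈ k₁.divisors, ∑ e ∈ k₂.divisors,
        ∫ u₁ in Ioi (0 : ℝ),
          (Real.log (Q / ((k₁ / d * (g * e) : ℕ) : ℝ)) + Real.log u₁) ^ 3 *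
          ∫ u₂ in Ioi ((((k₁ / d * (g * e) * (g * d * (k₂ / e)) : ℕ) : ℝ) / Q ^ 2) / u₁),
            Real.exp (-(u₁ + u₂)) / (1 - Real.exp (-(u₁ + u₂))) ^ 2 *
            (Real.log (Q / ((g * d * (k₂ / e) : ℕ) : ℝ)) + Real.log u₂) ^ 1 =
      (k₁.divisors.card : ℝ) * (k₂.divisors.card : ℝ) *
        (((2 * (Real.log Q - Real.log g) - Real.log k₁ - Real.log k₂) ^ 4 -
            3 * ((∑ p ∈ k₁.primeFactors, Real.log p ^ 2) + ∑ p ∈ k₂.primeFactors, Real.log p ^ 2) ^ 2 +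
            2 * ((∑ p ∈ k₁.primeFactors, Real.log p ^ 4) + ∑ p ∈ k₂.primeFactors, Real.log p ^ 4)) / 16 *
          (∫ u₁ in Ioi (0 : ℝ), ∫ u₂ in Ioi ((((g * g * (k₁ * k₂) : ℕ) : ℝ) / Q ^ 2) / u₁),
              Real.exp (-(u₁ + u₂)) / (1 - Real.exp (-(u₁ + u₂))) ^ 2) +
        ((2 * (Real.log Q - Real.log g) - Real.log k₁ - Real.log k₂) ^ 3 +
            3 * (2 * (Real.log Q - Real.log g) - Real.log k₁ - Real.log k₂) * ((∑ p ∈ k₁.primeFactors, Real.log p ^ 2) + ∑ p ∈ k₂.primeFactors, Real.log p ^ 2)) / 8 *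
          (∫ u₁ in Ioi (0 : ℝ), ∫ u₂ in Ioi ((((g * g * (k₁ * k₂) : ℕ) : ℝ) / Q ^ 2) / u₁),
              Real.exp (-(u₁ + u₂)) / (1 - Real.exp (-(u₁ + u₂))) ^ 2 * Real.log u₂) +
        (3 * (2 * (Real.log Q - Real.log g) - Real.log k₁ - Real.log k₂) ^ 3 -
            3 * (2 * (Real.log Q - Real.log g) - Real.log k₁ - Real.log k₂) * ((∑ p ∈ k₁.primeFactors, Real.log p ^ 2) + ∑ p ∈ k₂.primeFactors, Real.log p ^ 2)) / 8 *
          (∫ u₁ in Ioi (0 : ℝ), Real.log u₁ * ∫ u₂ in Ioi ((((g * g * (k₁ * k₂) : ℕ) : ℝ) / Q ^ 2) / u₁),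
              Real.exp (-(u₁ + u₂)) / (1 - Real.exp (-(u₁ + u₂))) ^ 2) +
        (3 * (2 * (Real.log Q - Real.log g) - Real.log k₁ - Real.log k₂) ^ 2 +
            3 * ((∑ p ∈ k₁.primeFactors, Real.log p ^ 2) + ∑ p ∈ k₂.primeFactors, Real.log p ^ 2)) / 4 *
          (∫ u₁ in Ioi (0 : ℝ), Real.log u₁ * ∫ u₂ in Ioi ((((g * g * (k₁ * k₂) : ℕ) : ℝ) / Q ^ 2) / u₁),
              Real.exp (-(u₁ + u₂)) / (1 - Real.exp (-(u₁ + u₂))) ^ 2 * Real.log u₂) +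
        (3 * (2 * (Real.log Q - Real.log g) - Real.log k₁ - Real.log k₂) ^ 2 -
            3 * ((∑ p ∈ k₁.primeFactors, Real.log p ^ 2) + ∑ p ∈ k₂.primeFactors, Real.log p ^ 2)) / 4 *
          (∫ u₁ in Ioi (0 : ℝ), Real.log u₁ ^ 2 * ∫ u₂ in Ioi ((((g * g * (k₁ * k₂) : ℕ) : ℝ) / Q ^ 2) / u₁),
              Real.exp (-(u₁ + u₂)) / (1 - Real.exp (-(u₁ + u₂))) ^ 2) +
        3 * (2 * (Real.log Q - Real.log g) - Real.log k₁ - Real.log k₂) / 2 *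
          (∫ u₁ in Ioi (0 : ℝ), Real.log u₁ ^ 2 * ∫ u₂ in Ioi ((((g * g * (k₁ * k₂) : ℕ) : ℝ) / Q ^ 2) / u₁),
              Real.exp (-(u₁ + u₂)) / (1 - Real.exp (-(u₁ + u₂))) ^ 2 * Real.log u₂) +
        (2 * (Real.log Q - Real.log g) - Real.log k₁ - Real.log k₂) / 2 *
          (∫ u₁ in Ioi (0 : ℝ), Real.log u₁ ^ 3 * ∫ u₂ in Ioi ((((g * g * (k₁ * k₂) : ℕ) : ℝ) / Q ^ 2) / u₁),
              Real.exp (-(u₁ + u₂)) / (1 - Real.exp (-(u₁ + u₂))) ^ 2) +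
        (∫ u₁ in Ioi (0 : ℝ), Real.log u₁ ^ 3 * ∫ u₂ in Ioi ((((g * g * (k₁ * k₂) : ℕ) : ℝ) / Q ^ 2) / u₁),
              Real.exp (-(u₁ + u₂)) / (1 - Real.exp (-(u₁ + u₂))) ^ 2 * Real.log u₂)) := by
  rw [heckeSum_order_eq 3 1 hQ hg hk₁.ne_zero hk₂.ne_zero]
  simp only [Finset.sum_range_succ, Finset.sum_range_zero, zero_add, Nat.sub_self, Nat.sub_zero,
    Nat.choose_zero_right, Nat.choose_self, Nat.choose_one_right, Nat.succ_sub_succ_eq_sub,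
    centralMoment_zero, centralMoment_one, centralMoment_three,
    centralMoment_two_of_squarefree hk₁, centralMoment_two_of_squarefree hk₂,
    centralMoment_four_of_squarefree hk₁, centralMoment_four_of_squarefree hk₂]
  simp only [pow_zero, pow_one, one_mul, mul_one, Nat.choose]
  push_cast
  ring

set_option maxHeartbeats 800000 in
-- one large `ring` normalisation (sixteen Bose coefficients, moments up to six)
/-- **Order `(3,3)`** (rung 3): `Σ_{d,e}𝔚₃₃ = τ(k₁)τ(k₂)·{(L ^ 6 - 3 * L ^ 4 * S₂ + 9 * L ^ 2 * S₂ ^ 2 - 6 * L ^ 2 * S₄ - 15 * S₂ ^ 3 + 30 * S₂ * S₄ - 16 * S₆) / 64·c₀₀ +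
  (3 * L ^ 5 - 6 * L ^ 3 * S₂ + 9 * L * S₂ ^ 2 - 6 * L * S₄) / 32·c₀₁ +
  (3 * L ^ 4 - 9 * S₂ ^ 2 + 6 * S₄) / 16·c₀₂ + (L ^ 3 + 3 * L * S₂) / 8·c₀₃ +
  (3 * L ^ 5 - 6 * L ^ 3 * S₂ + 9 * L * S₂ ^ 2 - 6 * L * S₄) / 32·c₁₀ +
  (9 * L ^ 4 - 18 * L ^ 2 * S₂ + 27 * S₂ ^ 2 - 18 * S₄) / 16·c₁₁ + (9 * L ^ 3 - 9 * L * S₂) / 8·c₁₂ +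
  (3 * L ^ 2 + 3 * S₂) / 4·c₁₃ + (3 * L ^ 4 - 9 * S₂ ^ 2 + 6 * S₄) / 16·c₂₀ + (9 * L ^ 3 - 9 * L * S₂) / 8·c₂₁ +
  (9 * L ^ 2 - 9 * S₂) / 4·c₂₂ + 3 * L / 2·c₂₃ + (L ^ 3 + 3 * L * S₂) / 8·c₃₀ + (3 * L ^ 2 + 3 * S₂) / 4·c₃₁ +
  3 * L / 2·c₃₂ + c₃₃}(g²k₁k₂/Q²)`
(`Q > 0`, `g ≥ 1`, squarefree `k₁, k₂`; `L = 2(log Q − log g) − log k₁ − log k₂`, `S_m = P_m(k₁) + P_m(k₂)`).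
[cite: KowalskiMichelVanderKam2000, (23)–(28) — derivation] -/
theorem heckeSum_orderThreeThree_eq {Q : ℝ} (hQ : 0 < Q) {g k₁ k₂ : ℕ} (hg : g ≠ 0) (hk₁ : Squarefree k₁)
    (hk₂ : Squarefree k₂) :
    ∑ d ∈ k₁.divisors, ∑ e ∈ k₂.divisors,
        ∫ u₁ in Ioi (0 : ℝ),
          (Real.log (Q / ((k₁ / d * (g * e) : ℕ) : ℝ)) + Real.log u₁) ^ 3 *
          ∫ u₂ in Ioi ((((k₁ / d * (g * e) * (g * d * (k₂ / e)) : ℕ) : ℝ) / Q ^ 2) / u₁),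
            Real.exp (-(u₁ + u₂)) / (1 - Real.exp (-(u₁ + u₂))) ^ 2 *
            (Real.log (Q / ((g * d * (k₂ / e) : ℕ) : ℝ)) + Real.log u₂) ^ 3 =
      (k₁.divisors.card : ℝ) * (k₂.divisors.card : ℝ) *
        (((2 * (Real.log Q - Real.log g) - Real.log k₁ - Real.log k₂) ^ 6 -
            3 * (2 * (Real.log Q - Real.log g) - Real.log k₁ - Real.log k₂) ^ 4 * ((∑ p ∈ k₁.primeFactors, Real.log p ^ 2) + ∑ p ∈ k₂.primeFactors, Real.log p ^ 2) +
            9 * (2 * (Real.log Q - Real.log g) - Real.log k₁ - Real.log k₂) ^ 2 * ((∑ p ∈ k₁.primeFactors, Real.log p ^ 2) + ∑ p ∈ k₂.primeFactors, Real.log p ^ 2) ^ 2 -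
            6 * (2 * (Real.log Q - Real.log g) - Real.log k₁ - Real.log k₂) ^ 2 * ((∑ p ∈ k₁.primeFactors, Real.log p ^ 4) + ∑ p ∈ k₂.primeFactors, Real.log p ^ 4) -
            15 * ((∑ p ∈ k₁.primeFactors, Real.log p ^ 2) + ∑ p ∈ k₂.primeFactors, Real.log p ^ 2) ^ 3 +
            30 * ((∑ p ∈ k₁.primeFactors, Real.log p ^ 2) + ∑ p ∈ k₂.primeFactors, Real.log p ^ 2) * ((∑ p ∈ k₁.primeFactors, Real.log p ^ 4) + ∑ p ∈ k₂.primeFactors, Real.log p ^ 4) -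
            16 * ((∑ p ∈ k₁.primeFactors, Real.log p ^ 6) + ∑ p ∈ k₂.primeFactors, Real.log p ^ 6)) / 64 *
          (∫ u₁ in Ioi (0 : ℝ), ∫ u₂ in Ioi ((((g * g * (k₁ * k₂) : ℕ) : ℝ) / Q ^ 2) / u₁),
              Real.exp (-(u₁ + u₂)) / (1 - Real.exp (-(u₁ + u₂))) ^ 2) +
        (3 * (2 * (Real.log Q - Real.log g) - Real.log k₁ - Real.log k₂) ^ 5 -
            6 * (2 * (Real.log Q - Real.log g) - Real.log k₁ - Real.log k₂) ^ 3 * ((∑ p ∈ k₁.primeFactors, Real.log p ^ 2) + ∑ p ∈ k₂.primeFactors, Real.log p ^ 2) +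
            9 * (2 * (Real.log Q - Real.log g) - Real.log k₁ - Real.log k₂) * ((∑ p ∈ k₁.primeFactors, Real.log p ^ 2) + ∑ p ∈ k₂.primeFactors, Real.log p ^ 2) ^ 2 -
            6 * (2 * (Real.log Q - Real.log g) - Real.log k₁ - Real.log k₂) * ((∑ p ∈ k₁.primeFactors, Real.log p ^ 4) + ∑ p ∈ k₂.primeFactors, Real.log p ^ 4)) / 32 *
          (∫ u₁ in Ioi (0 : ℝ), ∫ u₂ in Ioi ((((g * g * (k₁ * k₂) : ℕ) : ℝ) / Q ^ 2) / u₁),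
              Real.exp (-(u₁ + u₂)) / (1 - Real.exp (-(u₁ + u₂))) ^ 2 * Real.log u₂) +
        (3 * (2 * (Real.log Q - Real.log g) - Real.log k₁ - Real.log k₂) ^ 4 -
            9 * ((∑ p ∈ k₁.primeFactors, Real.log p ^ 2) + ∑ p ∈ k₂.primeFactors, Real.log p ^ 2) ^ 2 +
            6 * ((∑ p ∈ k₁.primeFactors, Real.log p ^ 4) + ∑ p ∈ k₂.primeFactors, Real.log p ^ 4)) / 16 *
          (∫ u₁ in Ioi (0 : ℝ), ∫ u₂ in Ioi ((((g * g * (k₁ * k₂) : ℕ) : ℝ) / Q ^ 2) / u₁),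
              Real.exp (-(u₁ + u₂)) / (1 - Real.exp (-(u₁ + u₂))) ^ 2 * Real.log u₂ ^ 2) +
        ((2 * (Real.log Q - Real.log g) - Real.log k₁ - Real.log k₂) ^ 3 +
            3 * (2 * (Real.log Q - Real.log g) - Real.log k₁ - Real.log k₂) * ((∑ p ∈ k₁.primeFactors, Real.log p ^ 2) + ∑ p ∈ k₂.primeFactors, Real.log p ^ 2)) / 8 *
          (∫ u₁ in Ioi (0 : ℝ), ∫ u₂ in Ioi ((((g * g * (k₁ * k₂) : ℕ) : ℝ) / Q ^ 2) / u₁),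
              Real.exp (-(u₁ + u₂)) / (1 - Real.exp (-(u₁ + u₂))) ^ 2 * Real.log u₂ ^ 3) +
        (3 * (2 * (Real.log Q - Real.log g) - Real.log k₁ - Real.log k₂) ^ 5 -
            6 * (2 * (Real.log Q - Real.log g) - Real.log k₁ - Real.log k₂) ^ 3 * ((∑ p ∈ k₁.primeFactors, Real.log p ^ 2) + ∑ p ∈ k₂.primeFactors, Real.log p ^ 2) +
            9 * (2 * (Real.log Q - Real.log g) - Real.log k₁ - Real.log k₂) * ((∑ p ∈ k₁.primeFactors, Real.log p ^ 2) + ∑ p ∈ k₂.primeFactors, Real.log p ^ 2) ^ 2 -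
            6 * (2 * (Real.log Q - Real.log g) - Real.log k₁ - Real.log k₂) * ((∑ p ∈ k₁.primeFactors, Real.log p ^ 4) + ∑ p ∈ k₂.primeFactors, Real.log p ^ 4)) / 32 *
          (∫ u₁ in Ioi (0 : ℝ), Real.log u₁ * ∫ u₂ in Ioi ((((g * g * (k₁ * k₂) : ℕ) : ℝ) / Q ^ 2) / u₁),
              Real.exp (-(u₁ + u₂)) / (1 - Real.exp (-(u₁ + u₂))) ^ 2) +
        (9 * (2 * (Real.log Q - Real.log g) - Real.log k₁ - Real.log k₂) ^ 4 -
            18 * (2 * (Real.log Q - Real.log g) - Real.log k₁ - Real.log k₂) ^ 2 * ((∑ p ∈ k₁.primeFactors, Real.log p ^ 2) + ∑ p ∈ k₂.primeFactors, Real.log p ^ 2) +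
            27 * ((∑ p ∈ k₁.primeFactors, Real.log p ^ 2) + ∑ p ∈ k₂.primeFactors, Real.log p ^ 2) ^ 2 -
            18 * ((∑ p ∈ k₁.primeFactors, Real.log p ^ 4) + ∑ p ∈ k₂.primeFactors, Real.log p ^ 4)) / 16 *
          (∫ u₁ in Ioi (0 : ℝ), Real.log u₁ * ∫ u₂ in Ioi ((((g * g * (k₁ * k₂) : ℕ) : ℝ) / Q ^ 2) / u₁),
              Real.exp (-(u₁ + u₂)) / (1 - Real.exp (-(u₁ + u₂))) ^ 2 * Real.log u₂) +
        (9 * (2 * (Real.log Q - Real.log g) - Real.log k₁ - Real.log k₂) ^ 3 -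
            9 * (2 * (Real.log Q - Real.log g) - Real.log k₁ - Real.log k₂) * ((∑ p ∈ k₁.primeFactors, Real.log p ^ 2) + ∑ p ∈ k₂.primeFactors, Real.log p ^ 2)) / 8 *
          (∫ u₁ in Ioi (0 : ℝ), Real.log u₁ * ∫ u₂ in Ioi ((((g * g * (k₁ * k₂) : ℕ) : ℝ) / Q ^ 2) / u₁),
              Real.exp (-(u₁ + u₂)) / (1 - Real.exp (-(u₁ + u₂))) ^ 2 * Real.log u₂ ^ 2) +
        (3 * (2 * (Real.log Q - Real.log g) - Real.log k₁ - Real.log k₂) ^ 2 +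
            3 * ((∑ p ∈ k₁.primeFactors, Real.log p ^ 2) + ∑ p ∈ k₂.primeFactors, Real.log p ^ 2)) / 4 *
          (∫ u₁ in Ioi (0 : ℝ), Real.log u₁ * ∫ u₂ in Ioi ((((g * g * (k₁ * k₂) : ℕ) : ℝ) / Q ^ 2) / u₁),
              Real.exp (-(u₁ + u₂)) / (1 - Real.exp (-(u₁ + u₂))) ^ 2 * Real.log u₂ ^ 3) +
        (3 * (2 * (Real.log Q - Real.log g) - Real.log k₁ - Real.log k₂) ^ 4 -
            9 * ((∑ p ∈ k₁.primeFactors, Real.log p ^ 2) + ∑ p ∈ k₂.primeFactors, Real.log p ^ 2) ^ 2 +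
            6 * ((∑ p ∈ k₁.primeFactors, Real.log p ^ 4) + ∑ p ∈ k₂.primeFactors, Real.log p ^ 4)) / 16 *
          (∫ u₁ in Ioi (0 : ℝ), Real.log u₁ ^ 2 * ∫ u₂ in Ioi ((((g * g * (k₁ * k₂) : ℕ) : ℝ) / Q ^ 2) / u₁),
              Real.exp (-(u₁ + u₂)) / (1 - Real.exp (-(u₁ + u₂))) ^ 2) +
        (9 * (2 * (Real.log Q - Real.log g) - Real.log k₁ - Real.log k₂) ^ 3 -
            9 * (2 * (Real.log Q - Real.log g) - Real.log k₁ - Real.log k₂) * ((∑ p ∈ k₁.primeFactors, Real.log p ^ 2) + ∑ p ∈ k₂.primeFactors, Real.log p ^ 2)) / 8 *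
          (∫ u₁ in Ioi (0 : ℝ), Real.log u₁ ^ 2 * ∫ u₂ in Ioi ((((g * g * (k₁ * k₂) : ℕ) : ℝ) / Q ^ 2) / u₁),
              Real.exp (-(u₁ + u₂)) / (1 - Real.exp (-(u₁ + u₂))) ^ 2 * Real.log u₂) +
        (9 * (2 * (Real.log Q - Real.log g) - Real.log k₁ - Real.log k₂) ^ 2 -
            9 * ((∑ p ∈ k₁.primeFactors, Real.log p ^ 2) + ∑ p ∈ k₂.primeFactors, Real.log p ^ 2)) / 4 *
          (∫ u₁ in Ioi (0 : ℝ), Real.log u₁ ^ 2 * ∫ u₂ in Ioi ((((g * g * (k₁ * k₂) : ℕ) : ℝ) / Q ^ 2) / u₁),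
              Real.exp (-(u₁ + u₂)) / (1 - Real.exp (-(u₁ + u₂))) ^ 2 * Real.log u₂ ^ 2) +
        3 * (2 * (Real.log Q - Real.log g) - Real.log k₁ - Real.log k₂) / 2 *
          (∫ u₁ in Ioi (0 : ℝ), Real.log u₁ ^ 2 * ∫ u₂ in Ioi ((((g * g * (k₁ * k₂) : ℕ) : ℝ) / Q ^ 2) / u₁),
              Real.exp (-(u₁ + u₂)) / (1 - Real.exp (-(u₁ + u₂))) ^ 2 * Real.log u₂ ^ 3) +
        ((2 * (Real.log Q - Real.log g) - Real.log k₁ - Real.log k₂) ^ 3 +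
            3 * (2 * (Real.log Q - Real.log g) - Real.log k₁ - Real.log k₂) * ((∑ p ∈ k₁.primeFactors, Real.log p ^ 2) + ∑ p ∈ k₂.primeFactors, Real.log p ^ 2)) / 8 *
          (∫ u₁ in Ioi (0 : ℝ), Real.log u₁ ^ 3 * ∫ u₂ in Ioi ((((g * g * (k₁ * k₂) : ℕ) : ℝ) / Q ^ 2) / u₁),
              Real.exp (-(u₁ + u₂)) / (1 - Real.exp (-(u₁ + u₂))) ^ 2) +
        (3 * (2 * (Real.log Q - Real.log g) - Real.log k₁ - Real.log k₂) ^ 2 +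
            3 * ((∑ p ∈ k₁.primeFactors, Real.log p ^ 2) + ∑ p ∈ k₂.primeFactors, Real.log p ^ 2)) / 4 *
          (∫ u₁ in Ioi (0 : ℝ), Real.log u₁ ^ 3 * ∫ u₂ in Ioi ((((g * g * (k₁ * k₂) : ℕ) : ℝ) / Q ^ 2) / u₁),
              Real.exp (-(u₁ + u₂)) / (1 - Real.exp (-(u₁ + u₂))) ^ 2 * Real.log u₂) +
        3 * (2 * (Real.log Q - Real.log g) - Real.log k₁ - Real.log k₂) / 2 *
          (∫ u₁ in Ioi (0 : ℝ), Real.log u₁ ^ 3 * ∫ u₂ in Ioi ((((g * g * (k₁ * k₂) : ℕ) : ℝ) / Q ^ 2) / u₁),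
              Real.exp (-(u₁ + u₂)) / (1 - Real.exp (-(u₁ + u₂))) ^ 2 * Real.log u₂ ^ 2) +
        (∫ u₁ in Ioi (0 : ℝ), Real.log u₁ ^ 3 * ∫ u₂ in Ioi ((((g * g * (k₁ * k₂) : ℕ) : ℝ) / Q ^ 2) / u₁),
              Real.exp (-(u₁ + u₂)) / (1 - Real.exp (-(u₁ + u₂))) ^ 2 * Real.log u₂ ^ 3)) := by
  rw [heckeSum_order_eq 3 3 hQ hg hk₁.ne_zero hk₂.ne_zero]
  simp only [Finset.sum_range_succ, Finset.sum_range_zero, zero_add, Nat.sub_self, Nat.sub_zero,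
    Nat.choose_zero_right, Nat.choose_self, Nat.choose_one_right, Nat.succ_sub_succ_eq_sub,
    centralMoment_zero, centralMoment_one, centralMoment_three,
    centralMoment_two_of_squarefree hk₁, centralMoment_two_of_squarefree hk₂,
    centralMoment_four_of_squarefree hk₁, centralMoment_four_of_squarefree hk₂, centralMoment_five,
    centralMoment_six_of_squarefree hk₁, centralMoment_six_of_squarefree hk₂]
  simp only [pow_zero, pow_one, one_mul, mul_one, Nat.choose]
  push_cast
  ring

end Summit.Parity.GeneralizedHardyLittlewood.Theorems.MomentsBeyondDiagonal.DiagKernel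

end
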